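import Summits.ABC.IUTFork.Cor312Ind3Real
import Mathlib.Algebra.Module.LinearMap.Rat
import Literature.IUT.LogThetaLattice.VerticallyCoricLGPArchHermitian
import HarnessLib

/-!
# [IUTchIII] Theorem 3.11 over real definitions — the PRINT-LEVEL archimedean integral structure on the real
# tensor packets: the Hermitian unit ball of Prop. 3.2 (ii) pulled back to `⨂_ℚ ⊕_{w|∞} K_w`, with print's
# (Ind3) inclusions PROVED and the typed all-places inclusion REFUTED

Record-only file (D-0012) of the abc-iut cell (WAVE-4 D-0067 cone-interior discharge prover, seat abc-iut-w4-d001,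
gen 2; home layer L6); TAKES NO SIDE on [IUTchIII] Cor. 3.12. Sequel to `Thm311RealArchShell` (same seat): there
the archimedean residual `harch : L.shellPk j ∞ ⊆ archPk j ∞` of the typed Thm. 3.11 (ii) at the real carriers
was shown to force the TRIVIAL binder `archPk j ∞ = univ`. This file supplies, for abc-iut-c312-5's real signature
`Real.logShells X logv Aut Ism …` (`Thm311Real`), the binder PRINT asks for, and measures the typed clauses
against it.

PRINT. [IUTchIII] Prop. 3.2 (ii), kurims `paper:url-4b091feeb646` p. 98 l. −4 – p. 99 l. 5: at `v_ℚ ∈ 𝕍^arc_ℚ`,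
"by regarding the mono-analytic log-shell “`𝓘_{†𝒟⊢_v}`” … as the “closed unit ball” of a Hermitian metric on
“`log(†𝒟⊢_v)`”, and considering the induced direct sum Hermitian metric on `log(^α𝒟⊢_{v_ℚ})`, together with the
induced tensor product Hermitian metric on `log(^A𝒟⊢_{v_ℚ})`, one obtains Hermitian metrics … whose associated
closed unit balls `𝓘(^A𝒟⊢_{v_ℚ}) ⊆ log(^A𝒟⊢_{v_ℚ})` … may be regarded as integral structures" — abc-iut-w4-d039's
`Literature.IUT.LogThetaLattice.hermitianBallN A V r` on `⨂_ℝ^{α∈A} ⊕_{v∈V} ℂ_v` (`TensorPacketsHermitian`, audited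
FAITHFUL). Prop. 3.5 (ii) (b) p. 105 ((Ind3) at archimedean primes): that ball "contains the image, via the
tensor product, over `|t| ∈ {0, …, j}`, of … both (1) the groups of units `(Ψ_cns(^{n,m}𝔉_≻)_{|t|})^×_v`, for
`𝕍 ∋ v | v_ℚ`, and (2) the closed balls of radius `π` inside `(Ψ_cns(^{n,m}𝔉_≻)_{|t|})^{gp}_v` …, for
`𝕍 ∋ v | v_ℚ`" — tensor products of vectors each living at ONE place `v` (this seat's
`Literature.IUT.LogThetaLattice.prop35ii_b_archHermitian`, p413763). [claim: Mochizuki2012, status: disputed]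

WHAT IS HERE (classical linear algebra + the isometries `K_w ≅ ℝ, ℂ`; every carrier is abc-iut-c312-5's).
* `Real.archEmb w : K_w →+* ℂ` (Mathlib `extensionEmbedding` at the archimedean place under `w`), an isometry
  (`Real.norm_archEmb`); `Real.archPacket1Map : ⊕_{w|∞} K_w →ₗ[ℚ] ⊕_{w|∞} ℂ_w`; the comparison
  **`Real.archComparison j : 𝓘^ℚ(^{S^±_{j+1}};𝒟⊢_∞) = ⨂_ℚ^{i ≤ j} ⊕_{w|∞} K_w →ₗ[ℚ] ⨂_ℝ^{i ≤ j} ⊕_{w|∞} ℂ_w`**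
  (`⊗_ℚ x ↦ ⊗_ℝ (archPacket1Map ∘ x)`, `Real.archComparison_tprod`; the map `β` of abc-iut-w4-d036 after the componentwise embeddings);
* **`Real.archPkHermitian j`** := the preimage of `hermitianBallN (S^±_{j+1}) {w|∞} π` — print's `𝓘(^A𝒟⊢_{v_ℚ})`
  at `v_ℚ = ∞` read on the real packet;
* PROVED, print's (Ind3) (b)(1)(2): a pure tensor of SINGLE-PLACE vectors of length `≤ π` (in particular of
  single-place units) lies in `archPkHermitian` (`Real.tprod_singlePlace_mem_archPkHermitian`,
  `Real.tprod_singlePlace_unit_mem_archPkHermitian`);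
* REFUTED, the typed reading: as soon as two archimedean places lie over `∞` (every `F ⊋ ℚ` totally complex of
  degree `≥ 4`, e.g. the `F ⊇ ℚ(√−1)` of [IUTchI] Def. 3.1 (a) with `[F:ℚ] ≥ 4`; any `F` with `r₁ + r₂ ≥ 2`), the
  typed (Ind3) image `L.tprodImages j ∞ (w ↦ I_w)` of abc-iut-c312-12 / abc-iut-w4-d087 (ALL-places vectors with
  every component in the shell) is NOT contained in `archPkHermitian` (`Real.tprodImages_shell_not_subset_archPkHermitian`:
  the pure tensor with every component `3 ∈ I_w` has tensor-metric square `(9·#{w|∞})^{j+1} > (π²)^{j+1}`); hence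
  `archPkHermitian j ≠ univ`, so (by `Thm311RealArchShell`) it cannot serve as the binder `archPk` of the typed
  route either (`Real.archPkHermitian_ne_univ`).
So on the real carriers: print's archimedean integral structure EXISTS as a definition and satisfies print's
(Ind3) clauses; the cell's typed (ii) is satisfiable at `v_ℚ = ∞` only with the trivial structure. Which clause the
real setting should carry is the typers'/referees' call (c312-5 `MRData.ofShells`, w4-d087 `partII_ofShells_*`,
c312-12 `LogShells.tprodImages`); nothing here is adjudicated. typed ≠ proved; instantiated ≠ endorsed.
Deliberately NOT here: log-volumes at `∞`, the (Ind1)/(Ind2) action on `archPkHermitian` (d039's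
`image_hermitianBallN_induced` is the ingredient), any judgement.
-/

noncomputable section

namespace Summit.ABC.IUTFork.Thm311.Real

open NumberField Literature.IUT.LogVolume Literature.IUT.LogVolume.Prop15iii Literature.IUT.LogThetaLattice
open PiTensorProduct

variable {F : Type} [Field F] [NumberField F]
variable (X : PilotData F) (logv : PadicLogs F) (Aut Ism : ∀ x : Place F, Set (Carrier x ≃ₗ[ℚ] Carrier x))
  (hAut : ∀ x, LinearEquiv.refl ℚ (Carrier x) ∈ Aut x) (hIsm : ∀ x, LinearEquiv.refl ℚ (Carrier x) ∈ Ism x)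

/-! ## 1. The archimedean fibre and the embeddings `K_w ↪ ℂ` -/

/-- `∞ ∈ V_ℚ` (the archimedean place of `ℚ` in abc-iut-c312-5's `RatPlace = Unit ⊕ Nat.Primes`). [folklore] -/
abbrev infty : (thetaIndex X).VQ := Sum.inl ()

/-- The set `{w ∈ V(F) | w | ∞}` of archimedean places, as the fibre of abc-iut-c312-5's index skeleton over
`∞ ∈ V_ℚ`. [folklore] -/
abbrev ArchFibre : Type := (thetaIndex X).Fibre (infty X)

/-- **`K_w ↪ ℂ`** at a place of the archimedean fibre: Mathlib's `extensionEmbedding` of the completion (the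
fibre over `∞` contains no finite place). [folklore] -/
def archEmb : ∀ w : ArchFibre X, Carrier w.1 →+* ℂ
  | ⟨.inl w, _⟩ => InfinitePlace.Completion.extensionEmbedding w
  | ⟨.inr _, h⟩ => absurd h (by simp [thetaIndex])

/-- `K_w ↪ ℂ` is an isometry: `‖archEmb w a‖ = ‖a‖`. [folklore] -/
theorem norm_archEmb : ∀ (w : ArchFibre X) (a : Carrier w.1), ‖archEmb X w a‖ = ‖a‖
  | ⟨.inl w, _⟩, a =>
    (InfinitePlace.Completion.isometry_extensionEmbedding w).norm_map_of_map_zero (map_zero _) a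
  | ⟨.inr _, h⟩, _ => absurd h (by simp [thetaIndex])

omit [NumberField F] in
/-- A natural number has its usual absolute value in the archimedean completion. [folklore] -/
theorem completion_norm_natCast (w : InfinitePlace F) (n : ℕ) : ‖((n : ℕ) : w.Completion)‖ = n := by
  rw [← (InfinitePlace.Completion.isometry_extensionEmbedding w).norm_map_of_map_zero (map_zero _) _,
    map_natCast, Complex.norm_natCast]

/-- The same in abc-iut-c312-5's carrier `K_w = Real.Carrier (inl w)`. [folklore] -/
theorem norm_natCast_inl (w : InfinitePlace F) (n : ℕ) : ‖((n : ℕ) : Carrier (.inl w : Place F))‖ = n :=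
  completion_norm_natCast w n

/-- A natural number has its usual absolute value in `K_w`, `w | ∞`. [folklore] -/
theorem norm_natCast_carrier : ∀ (w : ArchFibre X) (n : ℕ), ‖((n : ℕ) : Carrier w.1)‖ = n
  | ⟨.inl w, _⟩, n => norm_natCast_inl w n
  | ⟨.inr _, h⟩, _ => absurd h (by simp [thetaIndex])

/-! ## 2. The comparison `⨂_ℚ ⊕_{w|∞} K_w → ⨂_ℝ ⊕_{w|∞} ℂ_w` -/

/-- The 1-packet comparison `⊕_{w|∞} K_w → ⊕_{w|∞} ℂ_w = M {w|∞}` (componentwise `archEmb`, `ℚ`-linear).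
[folklore] -/
def archPacket1Map :
    (logShells X logv Aut Ism hAut hIsm).Packet1 (infty X) →ₗ[ℚ] M (ArchFibre X) :=
  LinearMap.pi fun w =>
    (archEmb X w).toAddMonoidHom.toRatLinearMap ∘ₗ
      LinearMap.proj (R := ℚ) (φ := fun w : ArchFibre X => (logShells X logv Aut Ism hAut hIsm).carrier w.1) w

/-- Componentwise: `archPacket1Map m w = archEmb w (m w)`. [folklore] -/
@[simp] theorem archPacket1Map_apply (m : (logShells X logv Aut Ism hAut hIsm).Packet1 (infty X))
    (w : ArchFibre X) : archPacket1Map X logv Aut Ism hAut hIsm m w = archEmb X w (m w) := by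
  simp only [archPacket1Map, LinearMap.pi_apply, LinearMap.comp_apply]
  rfl

/-- **The archimedean comparison** `𝓘^ℚ(^{S^±_{j+1}};𝒟⊢_∞) = ⨂_ℚ^{i ≤ j} ⊕_{w|∞} K_w →ₗ[ℚ] ⨂_ℝ^{i ≤ j} ⊕_{w|∞} ℂ_w =
M_{S^±_{j+1}}` ([IUTchIII] Prop. 3.1 (i) / Rmk. 3.1.1 (i) "topological tensor product", read at `∞` through the
base change `⊗_ℚ → ⊗_ℝ` — the map `β` of abc-iut-w4-d036's `prop35ii_b_archPacketRat` after the componentwise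
embeddings). [claim: Mochizuki2012, status: disputed] -/
def archComparison (j : (thetaIndex X).Label) :
    (logShells X logv Aut Ism hAut hIsm).Packet j (infty X) →ₗ[ℚ] MI ((thetaIndex X).Caps j) (ArchFibre X) :=
  PiTensorProduct.lift
    (((PiTensorProduct.tprod ℝ (s := fun _ : (thetaIndex X).Caps j => M (ArchFibre X))).restrictScalars
        ℚ).compLinearMap fun _ => archPacket1Map X logv Aut Ism hAut hIsm)

/-- On pure tensors: `archComparison (⊗_ℚ x) = ⊗_ℝ (archPacket1Map ∘ x)`. [folklore] -/
theorem archComparison_tprod (j : (thetaIndex X).Label)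
    (x : (thetaIndex X).Caps j → (logShells X logv Aut Ism hAut hIsm).Packet1 (infty X)) :
    archComparison X logv Aut Ism hAut hIsm j ((logShells X logv Aut Ism hAut hIsm).tprod j _ x) =
      tprod ℝ fun i => archPacket1Map X logv Aut Ism hAut hIsm (x i) := by
  show PiTensorProduct.lift
      (((PiTensorProduct.tprod ℝ (s := fun _ : (thetaIndex X).Caps j => M (ArchFibre X))).restrictScalars
          ℚ).compLinearMap fun _ => archPacket1Map X logv Aut Ism hAut hIsm) (tprod ℚ x) = _
  rw [PiTensorProduct.lift.tprod, MultilinearMap.compLinearMap_apply, MultilinearMap.coe_restrictScalars]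

/-! ## 3. Print's archimedean integral structure on the real packet -/

section Hermitian

variable [Fintype (ArchFibre X)]

/-- **`𝓘(^{S^±_{j+1}}𝒟⊢_∞)` ON THE REAL PACKET** ([IUTchIII] Prop. 3.2 (ii) p. 98–99): the preimage under the
archimedean comparison of abc-iut-w4-d039's closed unit ball `hermitianBallN` of the tensor-product Hermitian metric
(each log-shell `𝓘_w = {|a| ≤ π}` the unit ball of its factor). [claim: Mochizuki2012, status: disputed] -/
def archPkHermitian (j : (thetaIndex X).Label) : Set ((logShells X logv Aut Ism hAut hIsm).Packet j (infty X)) :=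
  archComparison X logv Aut Ism hAut hIsm j ⁻¹' hermitianBallN ((thetaIndex X).Caps j) (ArchFibre X) Real.pi

/-- Membership: `t ∈ 𝓘(^{S^±_{j+1}}𝒟⊢_∞)` iff its image lies in the Hermitian ball. [folklore] -/
theorem mem_archPkHermitian_iff (j : (thetaIndex X).Label)
    (t : (logShells X logv Aut Ism hAut hIsm).Packet j (infty X)) :
    t ∈ archPkHermitian X logv Aut Ism hAut hIsm j ↔
      archComparison X logv Aut Ism hAut hIsm j t ∈
        hermitianBallN ((thetaIndex X).Caps j) (ArchFibre X) Real.pi := Iff.rfl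

omit [Fintype (ArchFibre X)] in
/-- The image of a vector supported at one place `w` is `single_w (archEmb w (m w))`. [folklore] -/
theorem archPacket1Map_of_singlePlace [DecidableEq (ArchFibre X)] {m : (logShells X logv Aut Ism hAut hIsm).Packet1 (infty X)}
    {w : ArchFibre X} (hm : ∀ w', w' ≠ w → m w' = 0) :
    archPacket1Map X logv Aut Ism hAut hIsm m = Pi.single w (archEmb X w (m w)) := by
  funext w'
  rw [archPacket1Map_apply]
  by_cases hw : w' = w
  · subst hw; rw [Pi.single_eq_same]
  · rw [Pi.single_eq_of_ne hw, hm w' hw]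
    exact map_zero _

/-- **PRINT'S (Ind3) AT `∞`, clause (b)(2)** ([IUTchIII] Prop. 3.5 (ii)(b) p. 105): a pure tensor of
SINGLE-PLACE vectors of length `≤ π` — one element of the radius-`π` ball of `K_{w_i}` in the factor `i`, at one
place `w_i | ∞` per factor (length read in `ℂ` through the isometry `archEmb`, `Real.norm_archEmb`) — lies in
`𝓘(^{S^±_{j+1}}𝒟⊢_∞)`. [claim: Mochizuki2012, status: disputed] -/
theorem tprod_singlePlace_mem_archPkHermitian [DecidableEq (ArchFibre X)] (j : (thetaIndex X).Label)
    (x : (thetaIndex X).Caps j → (logShells X logv Aut Ism hAut hIsm).Packet1 (infty X))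
    (hx : ∀ i, ∃ w : ArchFibre X, (∀ w', w' ≠ w → x i w' = 0) ∧ ‖archEmb X w (x i w)‖ ≤ Real.pi) :
    (logShells X logv Aut Ism hAut hIsm).tprod j _ x ∈ archPkHermitian X logv Aut Ism hAut hIsm j := by
  rw [mem_archPkHermitian_iff, archComparison_tprod]
  refine tprod_mem_hermitianBallN fun i => ?_
  obtain ⟨w, hsupp, hnorm⟩ := hx i
  rw [show archPacket1Map X logv Aut Ism hAut hIsm (x i) = Pi.single w (archEmb X w (x i w)) from
    archPacket1Map_of_singlePlace X logv Aut Ism hAut hIsm hsupp]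
  exact single_mem_hermitianBall1 i w hnorm

/-- **PRINT'S (Ind3) AT `∞`, clause (b)(1)**: a pure tensor of single-place UNITS (`|·| = 1 ≤ π`) lies in
`𝓘(^{S^±_{j+1}}𝒟⊢_∞)`. [claim: Mochizuki2012, status: disputed] -/
theorem tprod_singlePlace_unit_mem_archPkHermitian [DecidableEq (ArchFibre X)] (j : (thetaIndex X).Label)
    (x : (thetaIndex X).Caps j → (logShells X logv Aut Ism hAut hIsm).Packet1 (infty X))
    (hx : ∀ i, ∃ w : ArchFibre X, (∀ w', w' ≠ w → x i w' = 0) ∧ ‖archEmb X w (x i w)‖ = 1) :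
    (logShells X logv Aut Ism hAut hIsm).tprod j _ x ∈ archPkHermitian X logv Aut Ism hAut hIsm j :=
  tprod_singlePlace_mem_archPkHermitian X logv Aut Ism hAut hIsm j x fun i => by
    obtain ⟨w, hsupp, hnorm⟩ := hx i
    refine ⟨w, hsupp, ?_⟩
    rw [hnorm]
    linarith [Real.pi_gt_three]

/-! ## 4. The typed all-places clause fails for the Hermitian ball -/

/-- The tensor-metric square of the image of the all-places pure tensor with every component the integer `3`:
`∏_i Σ_w |3|² = (9·#{w|∞})^{j+1}`. [folklore] -/
theorem tensorForm_archComparison_three (j : (thetaIndex X).Label) :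
    tensorForm ((thetaIndex X).Caps j) (ArchFibre X)
        (archComparison X logv Aut Ism hAut hIsm j
          ((logShells X logv Aut Ism hAut hIsm).tprod j _ fun _ w => ((3 : ℕ) : Carrier w.1)))
        (archComparison X logv Aut Ism hAut hIsm j
          ((logShells X logv Aut Ism hAut hIsm).tprod j _ fun _ w => ((3 : ℕ) : Carrier w.1))) =
      (9 * Fintype.card (ArchFibre X)) ^ ((j : ℕ) + 1) := by
  rw [archComparison_tprod, tensorForm_tprod_self]
  have h : ∀ i : (thetaIndex X).Caps j,
      dsInner (ArchFibre X) (archPacket1Map X logv Aut Ism hAut hIsm fun w => ((3 : ℕ) : Carrier w.1))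
        (archPacket1Map X logv Aut Ism hAut hIsm fun w => ((3 : ℕ) : Carrier w.1)) =
        9 * Fintype.card (ArchFibre X) := fun i => by
    rw [dsInner_self_eq]
    simp_rw [archPacket1Map_apply, norm_archEmb, norm_natCast_carrier]
    rw [Finset.sum_const, Finset.card_univ, nsmul_eq_mul]
    push_cast
    ring
  rw [Finset.prod_congr rfl fun i _ => h i, Finset.prod_const, Finset.card_univ, Fintype.card_fin]

/-- **THE TYPED ARCHIMEDEAN (Ind3) IMAGE IS NOT IN THE HERMITIAN BALL** once two archimedean places lie over `∞`:
abc-iut-c312-12's `L.tprodImages j ∞ (w ↦ I_w)` (pure tensors of ALL-places vectors with every component in the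
shell `I_w = {|a| ≤ π}` — the (Ind3) upper bound used by abc-iut-w4-d087's `partII_ofShells_honestImages`) contains
`⊗_i (3)_{w}`, whose tensor-metric square `(9·#{w|∞})^{j+1}` exceeds `(π²)^{j+1}`.
[claim: Mochizuki2012, status: disputed] -/
theorem tprodImages_shell_not_subset_archPkHermitian (j : (thetaIndex X).Label)
    (hV : 1 < Fintype.card (ArchFibre X)) :
    ¬ (logShells X logv Aut Ism hAut hIsm).tprodImages j (infty X)
          (fun w => (logShells X logv Aut Ism hAut hIsm).shell w.1) ⊆
        archPkHermitian X logv Aut Ism hAut hIsm j := by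
  intro h
  have hmem : (logShells X logv Aut Ism hAut hIsm).tprod j _ (fun _ w => ((3 : ℕ) : Carrier w.1)) ∈
      (logShells X logv Aut Ism hAut hIsm).tprodImages j (infty X)
        (fun w => (logShells X logv Aut Ism hAut hIsm).shell w.1) := by
    refine ⟨fun _ w => ((3 : ℕ) : Carrier w.1), fun i w => ?_, rfl⟩
    obtain ⟨x, hx⟩ := w
    rcases x with w' | v
    · show ((3 : ℕ) : Carrier (.inl w' : Place F)) ∈ shell logv (.inl w')
      rw [shell_inl, Set.mem_setOf_eq, norm_natCast_inl w' 3]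
      have := Real.pi_gt_three
      push_cast
      linarith
    · exact absurd hx (by simp [thetaIndex])
  have hball := h hmem
  rw [mem_archPkHermitian_iff, mem_hermitianBallN_iff, tensorForm_archComparison_three, Fintype.card_fin] at hball
  have hlt : Real.pi ^ 2 < 9 * Fintype.card (ArchFibre X) := by
    have h2 : (2 : ℝ) ≤ Fintype.card (ArchFibre X) := by exact_mod_cast hV
    nlinarith [Real.pi_lt_four, Real.pi_pos]
  have hpow : (Real.pi ^ 2) ^ ((j : ℕ) + 1) < (9 * Fintype.card (ArchFibre X) : ℝ) ^ ((j : ℕ) + 1) :=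
    pow_lt_pow_left₀ hlt (by positivity) (Nat.succ_ne_zero _)
  exact absurd hball (not_le.mpr hpow)

/-- **Hence print's ball cannot be the binder `archPk` of the typed route**: `𝓘(^{S^±_{j+1}}𝒟⊢_∞) ≠ univ` (two
archimedean places), while `Thm311RealArchShell.harch_iff_archPk_eq_univ` forces `archPk j ∞ = univ`.
[claim: Mochizuki2012, status: disputed] -/
theorem archPkHermitian_ne_univ (j : (thetaIndex X).Label) (hV : 1 < Fintype.card (ArchFibre X)) :
    archPkHermitian X logv Aut Ism hAut hIsm j ≠ Set.univ := fun h =>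
  tprodImages_shell_not_subset_archPkHermitian X logv Aut Ism hAut hIsm j hV (h ▸ Set.subset_univ _)

/-- Two distinct archimedean places give `1 < #{w | ∞}`. [folklore] -/
theorem one_lt_card_archFibre {w₁ w₂ : InfinitePlace F} (h : w₁ ≠ w₂) : 1 < Fintype.card (ArchFibre X) :=
  Fintype.one_lt_card_iff.mpr ⟨⟨.inl w₁, rfl⟩, ⟨.inl w₂, rfl⟩, fun e => h (Sum.inl_injective (congrArg Subtype.val e))⟩

end Hermitian

end Summit.ABC.IUTFork.Thm311.Real

end
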